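import Mathlib.LinearAlgebra.Matrix.Notation
import Mathlib.Tactic.LinearCombination
import Mathlib.Tactic.FinCases
import HarnessLib

/-!
# The 2×2 level-raising congruence ideal: `{s ∈ R[𝒰] : s ∈ M₂(R)·u} = (𝒰² − 1)·R[𝒰]` (cell `b2b-bsdres`, seat additive-p4 gen 34, line V58 — K104 = Lemma L2 of memo V58)

HONEST FRAMING (verbatim, cell `b2b-bsdres`): the goal of the cell is to DELETE the COMBINATION-SHAPED
residual classes for ALL analytic-rank `≤ 1` curves over `ℚ` — "full BSD formula for every rank `≤ 1`
curve in class `C`" assembled STRICTLY from published theorems — so that the rank-`≤ 1` remainder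
becomes exactly the CONSTRUCTION-SHAPED classes, which are TYPED (missing-input Props), NOT attempted;
this is not "finishing BSD". This file: PURE COMMUTATIVE ALGEBRA (no arithmetic input, no conjecture,
nothing booked; 0 defs). It machine-checks the one explicit computation ("Lemma L2") in the seat's
proof sketch (memo V58) that the two-prime old-space exactness T-V54 follows from multiplicity one.

## Setting

`R` a commutative ring (a localised Hecke algebra of level `M`), `T = T_ℓ ∈ R`, `ℓ ∈ R` (a prime,
invertible in `R` in the application — not needed here). On the `ℓ`-old part `H ⊕ H` of level `Mℓ`
the operator `U_ℓ` acts by a matrix `𝒰` with `𝒰² − T𝒰 + ℓ = 0`, and the two degeneracy maps have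
Gram matrix `u = i†i`. Ribet's / Diamond–Taylor–Wiles' level-raising congruence identity says that a
Hecke operator of level `Mℓ` supported on the `ℓ`-old part acts there as an element of
`𝔠 := {s ∈ R[𝒰] : s ∈ M₂(R)·u}`; Lemma L2 identifies `𝔠` with the principal ideal generated by
`η = 𝒰² − 1` (Ribet's `η_p = T_p² − ⟨p⟩`). We prove, WITHOUT ANY HYPOTHESIS on `R, T, ℓ`:

* `levelRaisingIdeal_iff` (normalisation A: modular-curve differentials `(α^*ω, β^*ω)`,
  `𝒰 = !![T, ℓ; -1, 0]`, untwisted Gram `u = !![ℓ+1, T; T, ℓ+1]`):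
  `(∃ m, a•1 + b•𝒰 = m * u) ↔ (∃ c d, a•1 + b•𝒰 = (c•1 + d•𝒰) * (𝒰*𝒰 − 1))`;
* `levelRaisingIdeal_iff_brandt` (normalisation D: Brandt-module divisor pull-backs,
  `𝒰 = !![0, -1; ℓ, T]`, Atkin–Lehner-twisted Gram `u = !![T, ℓ+1; ℓ+1, T]`): the same statement.

Both directions are by explicit witnesses (`𝒰² − 1 = !![-1, T; 0, -1] * u`, resp. `!![0, -1; -1, T] * u`;
conversely `c, d` are read off one row of `m`). A symbolic cross-check of five normalisations
(incl. these two) is kit j206617 / j206678 (gen34-evidence/v58).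

## References

* K. A. Ribet, Invent. Math. 100 (1990) 431–476, §3 and (6.1) (`σδ = η`). [cite: Ribet1990, §3, (6.1)]
* K. A. Ribet, Proc. ICM 1983 (1984), Thm. 4.1 (Ihara's lemma). [cite: Ribet1984ICM, Thm. 4.1]
* F. Diamond, "The refined conjecture of Serre", in: Elliptic curves, modular forms & Fermat's last theorem
  (Hong Kong 1993), pp. 22–37, §§3–4 (`η_p = T_p² − ⟨p⟩`). [cite: Diamond1995RefinedSerre, §§3–4]
-/

namespace Summit.BirchSwinnertonDyer.Rank1Residual.LevelLowering

open Matrix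

section LevelRaisingIdeal

variable {R : Type*} [CommRing R]

/-- Normalisation A (modular-curve differentials `(α^*ω, β^*ω)`): the matrix of `U_ℓ` on the
`ℓ`-old plane, `U(α^*ω) = T·α^*ω − β^*ω`, `U(β^*ω) = ℓ·α^*ω`. [cite: Ribet1990, §3] -/
theorem oldU_charpoly (T ℓ : R) :
    !![T, ℓ; -1, 0] * !![T, ℓ; -1, 0] = T • !![T, ℓ; -1, 0] - ℓ • (1 : Matrix (Fin 2) (Fin 2) R) := by
  ext i j
  fin_cases i <;> fin_cases j <;> simp [Matrix.mul_apply, Fin.sum_univ_two]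
  ring

/-- `𝒰² − 1 = !![-1, T; 0, -1] * u` in normalisation A: the element `η = 𝒰² − 1` lies in
`M₂(R)·u` for the untwisted Gram matrix `u = !![ℓ+1, T; T, ℓ+1]`. [cite: Ribet1990, §3, (6.1)] -/
theorem eta_eq_mul_gram (T ℓ : R) :
    !![T, ℓ; -1, 0] * !![T, ℓ; -1, 0] - (1 : Matrix (Fin 2) (Fin 2) R) =
      !![-1, T; 0, -1] * !![ℓ + 1, T; T, ℓ + 1] := by
  ext i j
  fin_cases i <;> fin_cases j <;> simp [Matrix.mul_apply, Fin.sum_univ_two] <;> ring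

/-- **Lemma L2 (memo V58), normalisation A.** For a commutative ring `R` and `T ℓ a b : R`, with
`𝒰 = !![T, ℓ; -1, 0]` (char. poly. `X² − TX + ℓ`) and Gram matrix `u = !![ℓ+1, T; T, ℓ+1]`:
`a·1 + b·𝒰` is a left `M₂(R)`-multiple of `u` iff it is an `R[𝒰]`-multiple of `𝒰² − 1`. No hypothesis
on `R`, `T`, `ℓ` is needed. [cite: Ribet1990, §3, (6.1)] [cite: Diamond1995RefinedSerre, §§3–4] -/
theorem levelRaisingIdeal_iff (T ℓ a b : R) :
    (∃ m : Matrix (Fin 2) (Fin 2) R,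
        a • (1 : Matrix (Fin 2) (Fin 2) R) + b • !![T, ℓ; -1, 0] = m * !![ℓ + 1, T; T, ℓ + 1]) ↔
    (∃ c d : R, a • (1 : Matrix (Fin 2) (Fin 2) R) + b • !![T, ℓ; -1, 0] =
        (c • (1 : Matrix (Fin 2) (Fin 2) R) + d • !![T, ℓ; -1, 0]) *
          (!![T, ℓ; -1, 0] * !![T, ℓ; -1, 0] - 1)) := by
  constructor
  · rintro ⟨m, hm⟩
    -- the second row of `a·1 + b·𝒰 = m·u` reads `(-b, a) = (m 1 0, m 1 1)·u`
    have h10 := congrFun (congrFun hm 1) 0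
    have h11 := congrFun (congrFun hm 1) 1
    simp [Matrix.mul_apply, Fin.sum_univ_two] at h10 h11
    refine ⟨-(m 1 1 + T * m 1 0), m 1 0, ?_⟩
    ext i j
    fin_cases i <;> fin_cases j
    · simp [Matrix.mul_apply, Fin.sum_univ_two]
      linear_combination h11 - T * h10
    · simp [Matrix.mul_apply, Fin.sum_univ_two]
      linear_combination (-ℓ) * h10
    · simp [Matrix.mul_apply, Fin.sum_univ_two]
      linear_combination h10
    · simp [Matrix.mul_apply, Fin.sum_univ_two]
      linear_combination h11
  · rintro ⟨c, d, hcd⟩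
    refine ⟨(c • (1 : Matrix (Fin 2) (Fin 2) R) + d • !![T, ℓ; -1, 0]) * !![-1, T; 0, -1], ?_⟩
    rw [hcd, eta_eq_mul_gram, Matrix.mul_assoc]

/-- Normalisation D (Brandt module of a definite quaternion algebra, divisor pull-backs
`(α^*, β^*)` on supersingular points): `U(α^*E) = ℓ·β^*E`, `U(β^*E) = β^*(T E) − α^*E`, so
`𝒰 = !![0, -1; ℓ, T]`; `𝒰² = T𝒰 − ℓ`. [cite: Ribet1990, §3] -/
theorem oldU_charpoly_brandt (T ℓ : R) :
    !![(0 : R), -1; ℓ, T] * !![(0 : R), -1; ℓ, T] =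
      T • !![(0 : R), -1; ℓ, T] - ℓ • (1 : Matrix (Fin 2) (Fin 2) R) := by
  ext i j
  fin_cases i <;> fin_cases j <;> simp [Matrix.mul_apply, Fin.sum_univ_two]
  ring

/-- `𝒰² − 1 = !![0, -1; -1, T] * u` in normalisation D, with the Atkin–Lehner-twisted Gram matrix
`u = !![T, ℓ+1; ℓ+1, T]`. [cite: Ribet1990, §3, (6.1)] -/
theorem eta_eq_mul_gram_brandt (T ℓ : R) :
    !![(0 : R), -1; ℓ, T] * !![(0 : R), -1; ℓ, T] - (1 : Matrix (Fin 2) (Fin 2) R) =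
      !![(0 : R), -1; -1, T] * !![T, ℓ + 1; ℓ + 1, T] := by
  ext i j
  fin_cases i <;> fin_cases j <;> simp [Matrix.mul_apply, Fin.sum_univ_two] <;> ring

/-- **Lemma L2 (memo V58), normalisation D** (Brandt module, twisted Gram matrix): with
`𝒰 = !![0, -1; ℓ, T]` and `u = !![T, ℓ+1; ℓ+1, T]`, `a·1 + b·𝒰 ∈ M₂(R)·u` iff
`a·1 + b·𝒰 ∈ (𝒰² − 1)·R[𝒰]`. No hypothesis on `R`, `T`, `ℓ`.
[cite: Ribet1990, §3, (6.1)] [cite: Diamond1995RefinedSerre, §§3–4] -/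
theorem levelRaisingIdeal_iff_brandt (T ℓ a b : R) :
    (∃ m : Matrix (Fin 2) (Fin 2) R,
        a • (1 : Matrix (Fin 2) (Fin 2) R) + b • !![(0 : R), -1; ℓ, T] = m * !![T, ℓ + 1; ℓ + 1, T]) ↔
    (∃ c d : R, a • (1 : Matrix (Fin 2) (Fin 2) R) + b • !![(0 : R), -1; ℓ, T] =
        (c • (1 : Matrix (Fin 2) (Fin 2) R) + d • !![(0 : R), -1; ℓ, T]) *
          (!![(0 : R), -1; ℓ, T] * !![(0 : R), -1; ℓ, T] - 1)) := by
  constructor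
  · rintro ⟨m, hm⟩
    -- the first row of `a·1 + b·𝒰 = m·u` reads `(a, -b) = (m 0 0, m 0 1)·u`
    have h00 := congrFun (congrFun hm 0) 0
    have h01 := congrFun (congrFun hm 0) 1
    simp [Matrix.mul_apply, Fin.sum_univ_two] at h00 h01
    refine ⟨-(m 0 1 + T * m 0 0), m 0 0, ?_⟩
    ext i j
    fin_cases i <;> fin_cases j
    · simp [Matrix.mul_apply, Fin.sum_univ_two]
      linear_combination h00
    · simp [Matrix.mul_apply, Fin.sum_univ_two]
      linear_combination h01
    · simp [Matrix.mul_apply, Fin.sum_univ_two]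
      linear_combination (-ℓ) * h01
    · simp [Matrix.mul_apply, Fin.sum_univ_two]
      linear_combination h00 - T * h01
  · rintro ⟨c, d, hcd⟩
    refine ⟨(c • (1 : Matrix (Fin 2) (Fin 2) R) + d • !![(0 : R), -1; ℓ, T]) * !![(0 : R), -1; -1, T], ?_⟩
    rw [hcd, eta_eq_mul_gram_brandt, Matrix.mul_assoc]

end LevelRaisingIdeal

end Summit.BirchSwinnertonDyer.Rank1Residual.LevelLowering
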